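import Mathlib
import HarnessLib
import Summits.HubbardSuperconductivity.HubbardSuperconductivity.Theorems.KLProgrammeKLRegimeTwoVolumeSrcBlockStepKit
import Summits.HubbardSuperconductivity.HubbardSuperconductivity.Theorems.KLProgrammeKLRegimeTwoVolumeSrcLawStepTwoScale

/-!
# Route `KLProgramme` — crux K3, VL child `KLRegimeVolumeLimitV17F3` (stmt-HubbardSuperconductivity-23356), producer route «(VL)-SRC-SOFT» §S5a (abstract half):
# THE SOURCE-SPECIES BLOCK STEP IN TWO-SCALE LAW-SHAPED CLOSED FORM — S3's door brackets (every cumulant order) ∘ E1's door-to-kit bricks and units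
# (`srcStep_le_kit_units`, S3b §1) ∘ the two-scale step T2₂ (`towerStep_le_twoScale`, S3c) (seat hubbard-kl-k3c4-p1 g19; `--supports` 23356)

This is the successor of `srcStep_le_law_of_profile_eps` (S3b §2, MERGED profile — located finding F2: one common per-pair constant for the alive and the source
species does not reproduce across blocks).  Here the dimensionless input array carries the TWO-SCALE profile of S3c,

  `μ d ≤ λ^{max(1,d−1)}·(C·Q^d + A·R^d) + a·[d = 1]`,  `0 ≤ Q ≤ R`,

(`C, Q`: the alive law read from `stub_vl_HE1free` at the block's bottom; `A, R`: the source species, `A = t·A_s` already rescaled; `a = t·a_s`: the budget-free degree two),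
and the conclusion has NO amplitude condition and NO per-vertex inflation factor:

* **`srcStep_le_twoScale_of_profile`** — with `σ̂ = κ²u`, `τ̂ = (e²(κ+ρ))²u`, `Φ̂ = (eα/κ²)·εKc`, `ψ̂ = ρ⁻²/u` and the rows `2λτ̂R ≤ 1`, `4σ̂λR ≤ ½`, `eτ̂λR ≤ ½`,
  `ŵ := Φ̂·2τ̂R·ζ ≤ ½` (`ζ = λz₀ + z₁`, `z₀ = CQ/(2R) + A/2`, `z₁ = a/(2R) + C(Q/R)² + A`), `Φ̂·V_b ≤ ½`:
  `b₀ ≤ t^{-s}·cr′·cc′^{2q+1}·(u^{q+1}·εKc)·[μ(q+1) + λ^q·((C+A)·λ·(4R)^{q+1}·8σ̂R + 2e·ŵ·ζ·(2τ̂ψ̂R)^{q+1})]`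
  — law shape `λ^{q}` in the output half-degree `q+1` with the per-pair constant set by the SOURCE scale `R` alone (`max(4R, 2τ̂ψ̂R)`), the zeroth order `μ(q+1)`
  riding along (S3 bounds the full output, not an increment).  The kit guard is DERIVED from the row `Φ̂·V_b ≤ ½` (`towerV_le_twoScale`).

Pure real algebra over landed lemmas; nothing about the model is asserted; nothing asserts any stub, VL, K3 or superconductivity.
References: BGM 2006 §2.8 (2.77), (2.81)–(2.83), §3 (3.2)–(3.8) [cite: BenfattoGiulianiMastropietro2006]; Gawȩdzki–Kupiainen 1985 §3 [cite: GawedzkiKupiainen1985GrossNeveu].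
-/

noncomputable section

namespace Summit.HubbardSuperconductivity.HubbardSuperconductivity.Theorems.TwoVolumeDefect

set_option linter.dupNamespace false -- summit = problem name (single-conjunct summit), D-0017

open Real Finset Literature.MathematicalPhysics.QuantumLattice
open Summit.HubbardSuperconductivity.HubbardSuperconductivity.Theorems.EngineV8

/-- **THE SOURCE-SPECIES BLOCK STEP IN TWO-SCALE LAW-SHAPED CLOSED FORM** (see the module docstring).  Hypotheses: as `srcStep_le_kit_units` without the guard
(`Γ` finite; `κ, ρ > 0`, `α, cr′, cc′ ≥ 0`; `t, ε, u, Kc > 0`; `μ ≥ 0`, `μ 0 = 0`; `D ≥ |Γ|/2`; S3's door brackets for every cumulant order `N₀ ≥ 2`), the two-scale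
profile on `[1, D]` and the five rows at `(σ̂, τ̂, Φ̂, ψ̂)`.  Conclusion:
`b₀ ≤ t^{-s}·cr′·cc′^{2q+1}·(u^{q+1}·εKc)·[μ(q+1) + λ^q·((C+A)·λ·(4R)^{q+1}·8σ̂R + 2e·(Φ̂·2τ̂Rζ)·ζ·(2τ̂ψ̂R)^{q+1})]`.
[cite: BenfattoGiulianiMastropietro2006, §2.8 (2.83), §3 (3.2)-(3.8); cite: GawedzkiKupiainen1985GrossNeveu, §3] -/
theorem srcStep_le_twoScale_of_profile {Γ : Type*} [Fintype Γ] {κ ρ α cr' cc' t ε u Kc b₀ lam Q R C A a : ℝ}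
    (hκ : 0 < κ) (hρ : 0 < ρ) (hα : 0 ≤ α) (hcr : 0 ≤ cr') (hcc : 0 ≤ cc') (ht : 0 < t) (hε : 0 < ε) (hu : 0 < u) (hKc : 0 < Kc)
    (hlam : 0 < lam) (hR : 0 < R) (hQ : 0 ≤ Q) (hQR : Q ≤ R) (hC : 0 ≤ C) (hA : 0 ≤ A) (ha : 0 ≤ a)
    {μ : ℕ → ℝ} (hμ0 : ∀ m, 0 ≤ μ m) (hμ00 : μ 0 = 0) {D : ℕ} (hD : Fintype.card Γ / 2 ≤ D)
    (hprof : ∀ d, 1 ≤ d → d ≤ D → μ d ≤ lam ^ max 1 (d - 1) * (C * Q ^ d + A * R ^ d) + (if d = 1 then a else 0)) (s q : ℕ)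
    (hb : ∀ N₀ : ℕ, 2 ≤ N₀ →
      b₀ ≤ t⁻¹ ^ s * (cr' * cc' ^ (2 * q + 1) *
        ((ε * Kc) * (u ^ (q + 1) * μ (q + 1)) +
         (∑ m' ∈ range (Fintype.card Γ / 2 + 1),
            if q + 1 < m' then ((2 * m').choose (2 * (q + 1)) : ℝ) * κ ^ (2 * m' - 2 * (q + 1)) * ((ε * Kc) * (u ^ m' * μ m')) else 0) +
         (∑ n ∈ Ico 2 N₀, (ρ⁻¹ ^ (2 * (q + 1)) * κ⁻¹ ^ (2 * (n - 1)) * (α ^ (n - 1) * Real.exp n)) *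
              ∑ δ ∈ (Fintype.piFinset fun _ : Fin n => range (Fintype.card Γ / 2 + 1)) with 2 * (q + 1) + 2 * (n - 1) ≤ ∑ a, 2 * δ a,
                ∏ a, (Real.exp 2 * (κ + ρ)) ^ (2 * δ a) * ((ε * Kc) * (u ^ (δ a) * μ (δ a))) +
            ρ⁻¹ ^ (2 * (q + 1)) * (Real.exp 1 * normV Γ κ ρ (fun m' => (ε * Kc) * (u ^ m' * μ m'))) *
              (Real.exp 1 * α * normV Γ κ ρ (fun m' => (ε * Kc) * (u ^ m' * μ m')) / κ ^ 2) ^ (N₀ - 1) /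
              (1 - Real.exp 1 * α * normV Γ κ ρ (fun m' => (ε * Kc) * (u ^ m' * μ m')) / κ ^ 2)))))
    -- T2₂'s rows at the kit's dimensionless constants
    (hx₂ : 2 * lam * ((Real.exp 2 * (κ + ρ)) ^ 2 * u) * R ≤ 1)
    (hx₁ : 4 * (κ ^ 2 * u) * lam * R ≤ 1 / 2)
    (hx₃ : Real.exp 1 * ((Real.exp 2 * (κ + ρ)) ^ 2 * u) * lam * R ≤ 1 / 2)
    (hw : (Real.exp 1 * α / κ ^ 2 * (ε * Kc)) * (2 * ((Real.exp 2 * (κ + ρ)) ^ 2 * u) * R *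
      (lam * (C * Q / (2 * R) + A / 2) + (a / (2 * R) + C * (Q / R) ^ 2 + A))) ≤ 1 / 2)
    (hV : (Real.exp 1 * α / κ ^ 2 * (ε * Kc)) *
      (Real.exp 1 * ((Real.exp 2 * (κ + ρ)) ^ 2 * u) * (lam * (C * Q + A * R) + a) +
        4 * lam * (Real.exp 1 * ((Real.exp 2 * (κ + ρ)) ^ 2 * u)) ^ 2 * (C * Q ^ 2 + A * R ^ 2)) ≤ 1 / 2) :
    b₀ ≤ t⁻¹ ^ s * (cr' * cc' ^ (2 * q + 1) * (u ^ (q + 1) * (ε * Kc))) *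
      (μ (q + 1) + lam ^ q * ((C + A) * lam * ((4 * R) ^ (q + 1) * (8 * (κ ^ 2 * u) * R)) +
        2 * Real.exp 1 * ((Real.exp 1 * α / κ ^ 2 * (ε * Kc)) * (2 * ((Real.exp 2 * (κ + ρ)) ^ 2 * u) * R *
            (lam * (C * Q / (2 * R) + A / 2) + (a / (2 * R) + C * (Q / R) ^ 2 + A)))) *
          (lam * (C * Q / (2 * R) + A / 2) + (a / (2 * R) + C * (Q / R) ^ 2 + A)) *
          (2 * ((Real.exp 2 * (κ + ρ)) ^ 2 * u) * (ρ⁻¹ ^ 2 / u) * R) ^ (q + 1))) := by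
  -- abbreviations for the dimensionless constants
  set σh : ℝ := κ ^ 2 * u with hσh
  set τh : ℝ := (Real.exp 2 * (κ + ρ)) ^ 2 * u with hτh
  set Φh : ℝ := Real.exp 1 * α / κ ^ 2 * (ε * Kc) with hΦh
  set ψh : ℝ := ρ⁻¹ ^ 2 / u with hψh
  have hσ0 : 0 ≤ σh := by positivity
  have hτpos : 0 < τh := by positivity
  have hΦ0 : 0 ≤ Φh := by positivity
  have hψ0 : 0 ≤ ψh := by positivity
  have hts : 0 ≤ t⁻¹ ^ s := pow_nonneg (inv_nonneg.2 ht.le) _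
  have hpre : 0 ≤ t⁻¹ ^ s * (cr' * cc' ^ (2 * q + 1) * (u ^ (q + 1) * (ε * Kc))) := by positivity
  set Pre : ℝ := t⁻¹ ^ s * (cr' * cc' ^ (2 * q + 1) * (u ^ (q + 1) * (ε * Kc))) with hPre
  -- the right bracket is nonnegative
  have hz₀0 : 0 ≤ C * Q / (2 * R) + A / 2 := by positivity
  have hz₁0 : 0 ≤ a / (2 * R) + C * (Q / R) ^ 2 + A := by positivity
  have hζ0 : 0 ≤ lam * (C * Q / (2 * R) + A / 2) + (a / (2 * R) + C * (Q / R) ^ 2 + A) := by positivity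
  have hBr : 0 ≤ lam ^ q * ((C + A) * lam * ((4 * R) ^ (q + 1) * (8 * σh * R)) +
      2 * Real.exp 1 * (Φh * (2 * τh * R * (lam * (C * Q / (2 * R) + A / 2) + (a / (2 * R) + C * (Q / R) ^ 2 + A)))) *
        (lam * (C * Q / (2 * R) + A / 2) + (a / (2 * R) + C * (Q / R) ^ 2 + A)) * (2 * τh * ψh * R) ^ (q + 1)) := by
    positivity
  -- the reduced left side `b := b₀/Pre − μ(q+1)` obeys T2₂'s `hstep` (when `Pre > 0`; the case `Pre = 0` is trivial)
  rcases hpre.eq_or_lt with hPre0 | hPre0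
  · have h2 := hb 2 le_rfl
    have hfac : t⁻¹ ^ s * (cr' * cc' ^ (2 * q + 1)) = 0 := by
      have hne : u ^ (q + 1) * (ε * Kc) ≠ 0 := by positivity
      have hprod : t⁻¹ ^ s * (cr' * cc' ^ (2 * q + 1)) * (u ^ (q + 1) * (ε * Kc)) = 0 := by
        rw [show t⁻¹ ^ s * (cr' * cc' ^ (2 * q + 1)) * (u ^ (q + 1) * (ε * Kc)) = Pre by rw [hPre]; ring]
        exact hPre0.symm
      exact (mul_eq_zero.1 hprod).resolve_right hne
    have hb0 : b₀ ≤ 0 := by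
      refine h2.trans (le_of_eq ?_)
      rw [← mul_assoc, hfac, zero_mul]
    refine hb0.trans ?_
    rw [← hPre0, zero_mul]
  -- `Pre > 0`
  set b : ℝ := b₀ / Pre - μ (q + 1) with hbdef
  have hstep : ∀ N : ℕ, 2 ≤ N → Φh * towerV D τh μ < 1 →
      b ≤ towerFO D σh μ (q + 1) + ∑ n ∈ Icc 2 N, Real.exp 1 * Φh ^ (n - 1) * ψh ^ (q + 1) * towerS D τh μ n (q + 1) +
        ψh ^ (q + 1) * Real.exp 1 * towerV D τh μ * (Φh * towerV D τh μ) ^ N / (1 - Φh * towerV D τh μ) := by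
    intro N hN hg
    have h := srcStep_le_kit_units (Γ := Γ) hκ hρ hα hcr hcc ht hε hu hKc hμ0 hμ00 hD s q hb
      (by simpa only [hΦh, hτh, mul_assoc] using hg) (N₀ := N + 1) (by omega)
    rw [Nat.add_sub_cancel] at h
    rw [hbdef, sub_le_iff_le_add, div_le_iff₀ hPre0]
    refine h.trans (le_of_eq ?_)
    rw [hPre, hσh, hτh, hΦh, hψh]
    ring
  have hT2 := towerStep_le_twoScale (D := D) (μ := μ) (b := b) hσ0 hΦ0 hψ0 hτpos hlam hR hQ hQR hC hA ha hμ0 hprof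
    (by simpa only [hτh] using hx₂) (by simpa only [hσh] using hx₁) (by simpa only [hτh] using hx₃)
    (by simpa only [hΦh, hτh] using hw) (by simpa only [hΦh, hτh] using hV) (p := q + 1) (by omega) hstep
  rw [Nat.add_sub_cancel] at hT2
  have hb₀ : b₀ = Pre * (μ (q + 1) + b) := by
    rw [hbdef, add_sub_cancel, mul_div_cancel₀ _ hPre0.ne']
  rw [hb₀]
  refine mul_le_mul_of_nonneg_left (add_le_add le_rfl (hT2.trans (le_of_eq ?_))) hpre
  rw [hσh, hτh, hΦh, hψh]

end Summit.HubbardSuperconductivity.HubbardSuperconductivity.Theorems.TwoVolumeDefect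

end
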